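import Summits.AtomisticToContinuum.Crystallization.Theorems.FrustratedLawDichotomyExemptRemoval

/-!
# FrustratedLawDichotomy · crux `AperiodicFrustratedLawGap` (stmt-AtomisticToContinuum-27623) — THE LOCAL-OPTIMALITY EXEMPTION
# («OptimalityCut»: sites that fail Sütő's μ-equilibrium test INSIDE THEIR OWN ϱ-BALL, up to slack ε, are FREE)
# (decomp-a2c, prover hand 2, structural share, generation 14; generic, radius-free; = lens-5 g37 AUDIT §D «LocOpt / FDGopt / DoorOpt»)

Second instance of the exemption door `FrustratedLawDichotomyExemptDoor` (`DeepAbsent M Ex ∧ ExemptFDG Ex ⟹ LCO ⟹` crux BY NAME).  The site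
predicate is lens-5's `(ε, ϱ, K)`-LOCAL OPTIMALITY at chemical potential `μ` (audit memo HOME/decomp-a2c-lens-5/g37/AUDIT-g37.md §D4), typed in
the currency of `Literature…MuGSC.IsMuGSC` localised to the ball `B̄(y_j, ϱ)` of the finite cluster `y`:

* `LocOpt μ ε ϱ K y j` — for every sub-configuration `s` of `y` of `≤ K` atoms inside `B̄(y_j, ϱ)` and every injective competitor `R` of `≤ K`
  points inside `B̄(y_j, ϱ)` avoiding `y ∖ s`:  `U(s) + I(s, y∖s) − μ·#s ≤ U(R) + I(R, y∖s) − μ·#R + ε`  (all deletions, insertions, one-atom moves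
  and `K`-atom rearrangements inside the ball; `I = fieldEnergy V_LJ`, finite sums here);
* `LocOptFails μ ε ϱ K` — its negation (the exemption), and the `e⋆`-FREE sub-predicate `ExchangeUnstable ε ϱ K` (a particle-conserving
  rearrangement inside the ball gains more than `ε`; covers Nash / force imbalance at finite step);
* ★ `deepAbsent_locOptFails` — lens-5's «only new estimate»: at depth `locOptDepth ε ϱ K = ϱ + removalDepth (ε/(2K+1))` inside a window of a
  rooted `7/10`-separated `e⋆`-μGSC `X`, EVERY site is `(ε, ϱ, K)`-locally optimal at `μ = e⋆`: Sütő's inequality for `(s, R)` in `X`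
  (`IsMuGSC.le`) differs from the window's by the fields of the atoms outside the window, all farther than `removalDepth (ε/(2K+1))` from the
  ball, i.e. by at most `(#s + #R)·T ≤ 2K·ε/(2K+1) ≤ ε` (`abs_fieldEnergy_far_le`, the tree's `abs_tsum_field_le_of_far`); the competitor `R`
  avoids `X ∖ s` because it avoids `y ∖ s` and lies inside the window;
* `deepAbsent_exchangeUnstable` (by `DeepAbsent.of_imp`);
* BY NAME: `aperiodicFrustratedLawGap_of_locOptExempt` (`MuEquilibriumDoor ∧ ExemptFDG (LocOptFails e⋆ ε ϱ K) ⟹` crux, every `ε > 0`, `ϱ`, `K`), the sibling 27624, the `e⋆`-free exchange form, and at the node of record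
  `aperiodicFrustratedLawGap_of_schurCut_locOpt_fourHalf` : `MuEquilibriumDoor ∧ SF₄₅ ∧ UP(−0.7175) ∧
  FRG♭_X(w₄₅, ω₄, 3/400; −0.7174, C, LocOptFails e⋆ ε ϱ K) ⟹` crux (lens-5's `FDGopt`/`Topt♭` feed, unsplit form; `D = C`).

So lens-5's node needs no door file: `DoorOpt` is `localCloseOrder_of_exemptFDG` + this file.  The adversary space of every finite certificate
beneath `T′♭₄₅ / FRG♭₄₅` shrinks from «`7/10`-legal» to «`7/10`-legal AND `(ε, ϱ, K)`-optimal around the receiver» (ε-equilibria); the audit's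
killers (density steps, thin dense platelets, the hedgehog) are all `10²–10⁴×` non-optimal (AUDIT-g37 D1–D2).  All `[folklore]` bookkeeping.
-/

noncomputable section

namespace Summit.AtomisticToContinuum.Crystallization.Theorems.FrustratedLawDichotomyExemptLocOpt

open Metric
open Literature.MathematicalPhysics.StatisticalMechanics
open Summit.AtomisticToContinuum.Crystallization.Theorems.ChargedEnergyGapNegative (E3 eStar)
open Summit.AtomisticToContinuum.Crystallization.Theorems.FrustratedLawDichotomyGSCClusterExactness (summable_of_subset)
open Summit.AtomisticToContinuum.Crystallization.Theorems.FrustratedLawDichotomyGSCVanHoveBalls (abs_tsum_field_le_of_far)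
open Summit.AtomisticToContinuum.Crystallization.Theorems.FrustratedLawDichotomyExemptDoor
open Summit.AtomisticToContinuum.Crystallization.Theorems.FrustratedLawDichotomyExemptRemoval
  (tailConst tailConst_nonneg removalDepth one_le_removalDepth tailConst_removalDepth_le SchurRangeGapX exemptFDG_of_schurCutX
    aperiodicFrustratedLawGap_of_schurCutX_fourHalf)
open Summit.AtomisticToContinuum.Crystallization.Theorems.FrustratedLawDichotomyRangeCut
  (Sep GoodAt FDG PeriodicEnergyCeiling eStar_le_of_periodicEnergyCeiling)
open Summit.AtomisticToContinuum.Crystallization.Theorems.FrustratedLawDichotomySchurCut (SchurFloor effPot w₄₅ ω₄ SF₄₅)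

/-! ## §1. Local optimality inside the ϱ-ball (Sütő's test, localised, with slack) -/

/-- **`(ε, ϱ, K)`-LOCAL OPTIMALITY of the site `j` of the finite cluster `y` at chemical potential `μ`** (lens-5 g37 §D4 `LocOpt`): for every
sub-configuration `s` of `y` with `#s ≤ K` inside `B̄(y_j, ϱ)` and every injective `R` with `#R ≤ K` inside `B̄(y_j, ϱ)` avoiding `y ∖ s`,
`U(s) + I(s, y∖s) − μ·#s ≤ U(R) + I(R, y∖s) − μ·#R + ε` (`I = fieldEnergy V_LJ`). -/
def LocOpt (μ ε ϱ : ℝ) (K : ℕ) : SitePred := fun _ y j =>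
  ∀ (a : ℕ) (s : Fin a → EuclideanSpace ℝ (Fin 3)), a ≤ K → Function.Injective s → Set.range s ⊆ Set.range y →
    (∀ l, dist (s l) (y j) ≤ ϱ) →
    ∀ (m : ℕ) (R : Fin m → EuclideanSpace ℝ (Fin 3)), m ≤ K → Function.Injective R → (∀ l, dist (R l) (y j) ≤ ϱ) →
      Disjoint (Set.range R) (Set.range y \ Set.range s) →
        interactionEnergy lennardJones s + (∑ i, ∑' q : ↥(Set.range y \ Set.range s), lennardJones (dist (s i) q)) - μ * a ≤
          interactionEnergy lennardJones R + (∑ i, ∑' q : ↥(Set.range y \ Set.range s), lennardJones (dist (R i) q)) - μ * m + ε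

/-- **The local-optimality EXEMPTION**: the site fails `(ε, ϱ, K)`-local optimality at `μ`. -/
def LocOptFails (μ ε ϱ : ℝ) (K : ℕ) : SitePred := fun N y j => ¬ LocOpt μ ε ϱ K N y j

/-- **`K`-EXCHANGE INSTABILITY** (`μ`-free): some sub-configuration `s` of `≤ K` atoms of `y` inside `B̄(y_j, ϱ)` and an injective
competitor `R` with THE SAME number of points inside the ball, avoiding `y ∖ s`, satisfy `U(R) + I(R, y∖s) + ε < U(s) + I(s, y∖s)`
(one-atom moves: Nash / force balance at finite step; `K`-atom rearrangements). -/
def ExchangeUnstable (ε ϱ : ℝ) (K : ℕ) : SitePred := fun _ y j =>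
  ∃ (a : ℕ) (s R : Fin a → EuclideanSpace ℝ (Fin 3)), a ≤ K ∧ Function.Injective s ∧ Set.range s ⊆ Set.range y ∧
    (∀ l, dist (s l) (y j) ≤ ϱ) ∧ Function.Injective R ∧ (∀ l, dist (R l) (y j) ≤ ϱ) ∧
    Disjoint (Set.range R) (Set.range y \ Set.range s) ∧
      interactionEnergy lennardJones R + (∑ i, ∑' q : ↥(Set.range y \ Set.range s), lennardJones (dist (R i) q)) + ε <
        interactionEnergy lennardJones s + (∑ i, ∑' q : ↥(Set.range y \ Set.range s), lennardJones (dist (s i) q))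

/-- An exchange-unstable site fails local optimality at EVERY chemical potential. [folklore] -/
theorem locOptFails_of_exchangeUnstable (μ : ℝ) {ε ϱ : ℝ} {K : ℕ} {N : ℕ} {y : Fin N → EuclideanSpace ℝ (Fin 3)} {j : Fin N}
    (h : ExchangeUnstable ε ϱ K N y j) : LocOptFails μ ε ϱ K N y j := by
  obtain ⟨a, s, R, haK, hs, hsY, hsball, hR, hRball, hdisj, hlt⟩ := h
  intro hopt
  have := hopt a s haK hs hsY hsball a R haK hR hRball hdisj
  linarith

/-! ## §2. Fields of far atoms, and splitting a field at the window -/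

/-- Splitting a field over `X ∖ S` at a window `A` (`S ⊆ A ⊆ X`): `Σ'_{X∖S} = Σ'_{A∖S} + Σ'_{X∖A}`. [folklore] -/
theorem tsum_sdiff_split {X A S : Set (EuclideanSpace ℝ (Fin 3))} (hsum : ∀ r : EuclideanSpace ℝ (Fin 3), Summable fun y : ↥X => lennardJones (dist r y))
    (hAX : A ⊆ X) (hSA : S ⊆ A) (z : EuclideanSpace ℝ (Fin 3)) :
    ∑' y : ↥(X \ S), lennardJones (dist z y) =
      (∑' y : ↥(A \ S), lennardJones (dist z y)) + ∑' y : ↥(X \ A), lennardJones (dist z y) := by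
  set f : EuclideanSpace ℝ (Fin 3) → ℝ := fun y => lennardJones (dist z y) with hf
  have hfX : Summable (f ∘ (↑) : ↥X → ℝ) := hsum z
  have h1 : Summable (f ∘ (↑) : ↥(A \ S) → ℝ) := summable_of_subset hfX ((fun y (hy : y ∈ A \ S) => hAX hy.1))
  have h2 : Summable (f ∘ (↑) : ↥(X \ A) → ℝ) := summable_of_subset hfX (fun y (hy : y ∈ X \ A) => hy.1)
  have hdisj : Disjoint (A \ S) (X \ A) := Set.disjoint_left.2 fun y hy hy' => hy'.2 hy.1
  have hunion : X \ S = (A \ S) ∪ (X \ A) := by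
    ext y
    constructor
    · rintro ⟨hyX, hyS⟩
      by_cases hyA : y ∈ A
      · exact Or.inl ⟨hyA, hyS⟩
      · exact Or.inr ⟨hyX, hyA⟩
    · rintro (⟨hyA, hyS⟩ | ⟨hyX, hyA⟩)
      · exact ⟨hAX hyA, hyS⟩
      · exact ⟨hyX, fun h => hyA (hSA h)⟩
  calc ∑' y : ↥(X \ S), f y = ∑' y : ↥((A \ S) ∪ (X \ A)), f y := tsum_congr_set_coe f hunion
    _ = (∑' y : ↥(A \ S), f y) + ∑' y : ↥(X \ A), f y := h1.tsum_union_disjoint hdisj h2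

/-- The same split for the field energy of a finite configuration. [folklore] -/
theorem fieldEnergy_sdiff_split {X A S : Set (EuclideanSpace ℝ (Fin 3))}
    (hsum : ∀ r : EuclideanSpace ℝ (Fin 3), Summable fun y : ↥X => lennardJones (dist r y)) (hAX : A ⊆ X) (hSA : S ⊆ A)
    {a : ℕ} (x : Fin a → EuclideanSpace ℝ (Fin 3)) :
    ∑ i, ∑' y : ↥(X \ S), lennardJones (dist (x i) y) =
      (∑ i, ∑' y : ↥(A \ S), lennardJones (dist (x i) y)) + ∑ i, ∑' y : ↥(X \ A), lennardJones (dist (x i) y) := by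
  rw [← Finset.sum_add_distrib]
  exact Finset.sum_congr rfl fun i _ => tsum_sdiff_split hsum hAX hSA (x i)

/-- **Far-field bound for a finite configuration**: if every point of `x` is at distance `≥ D ≥ 7/10` from every atom of the `7/10`-separated
set `Y`, then `|I(x, Y)| ≤ #x · T(D)`. [folklore] -/
theorem abs_fieldEnergy_far_le {Y : Set (EuclideanSpace ℝ (Fin 3))}
    (hsepY : ∀ a ∈ Y, ∀ b ∈ Y, a ≠ b → (7 : ℝ) / 10 ≤ dist a b) {D : ℝ} (hD : (7 : ℝ) / 10 ≤ D)
    {a : ℕ} (x : Fin a → EuclideanSpace ℝ (Fin 3)) (hx : ∀ i, ∀ y ∈ Y, D ≤ dist (x i) y) :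
    |∑ i, ∑' y : ↥Y, lennardJones (dist (x i) y)| ≤ a * tailConst D := by
  calc |∑ i, ∑' y : ↥Y, lennardJones (dist (x i) y)| ≤ ∑ i, |∑' y : ↥Y, lennardJones (dist (x i) y)| :=
        Finset.abs_sum_le_sum_abs _ _
    _ ≤ ∑ _i : Fin a, tailConst D := Finset.sum_le_sum fun i _ =>
        abs_tsum_field_le_of_far (by norm_num : (0 : ℝ) < 7 / 10) hsepY (x i) hD (hx i)
    _ = a * tailConst D := by simp

/-! ## §3. Local optimality is inherited by deep window sites (deep absence of its failure) -/

/-- **The depth** at which `(ε, ϱ, K)`-optimality is inherited: `ϱ + removalDepth (ε / (2K+1))`. -/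
def locOptDepth (ε ϱ : ℝ) (K : ℕ) : ℝ := ϱ + removalDepth (ε / (2 * K + 1))

/-- ★ **FAILURE OF LOCAL OPTIMALITY IS DEEP-ABSENT** (lens-5's `DoorOpt` estimate): for `ε > 0` and any `ϱ`, `K`, every site deeper than
`locOptDepth ε ϱ K` inside a window of a rooted `7/10`-separated `e⋆`-μGSC of `V_LJ` is `(ε, ϱ, K)`-locally optimal at `μ = e⋆`. [folklore] -/
theorem deepAbsent_locOptFails {ε ϱ : ℝ} {K : ℕ} (hε : 0 < ε) :
    DeepAbsent (locOptDepth ε ϱ K) (LocOptFails eStar ε ϱ K) := by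
  intro X _ hsep hGSC r n xf hinj hrange j hj hfail
  apply hfail
  intro a s haK hs hsY hsball m R hmK hR hRball hdisj
  have h2K1 : (0 : ℝ) < 2 * K + 1 := by positivity
  set t : ℝ := ε / (2 * K + 1) with htdef
  have ht : 0 < t := div_pos hε h2K1
  set D : ℝ := removalDepth t with hDdef
  have hD1 : (1 : ℝ) ≤ D := one_le_removalDepth t
  have hD7 : (7 : ℝ) / 10 ≤ D := le_trans (by norm_num) hD1
  have hTD : tailConst D ≤ t := tailConst_removalDepth_le ht
  have hT0 : 0 ≤ tailConst D := tailConst_nonneg (by linarith)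
  have hdepth : ‖xf j‖ + ϱ + D ≤ r := by
    have : locOptDepth ε ϱ K = ϱ + D := rfl
    linarith
  have hsub : Set.range xf ⊆ X := hrange.le.trans Set.inter_subset_left
  have hsX : Set.range s ⊆ X := hsY.trans hsub
  -- points of the ball are deep
  have hnear : ∀ z : EuclideanSpace ℝ (Fin 3), dist z (xf j) ≤ ϱ → ‖z‖ + D ≤ r := by
    intro z hz
    have h1 : ‖z‖ ≤ ‖xf j‖ + dist z (xf j) := by
      rw [dist_eq_norm]
      have := norm_add_le (xf j) (z - xf j)
      rwa [add_sub_cancel] at this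
    linarith
  -- atoms outside the window are far from the ball
  have hfar : ∀ z : EuclideanSpace ℝ (Fin 3), dist z (xf j) ≤ ϱ → ∀ y ∈ X \ Set.range xf, D ≤ dist z y := by
    intro z hz y hy
    have hyr : r < ‖y‖ := by
      by_contra hle
      rw [not_lt] at hle
      exact hy.2 (by rw [hrange]; exact ⟨hy.1, mem_closedBall_zero_iff.2 hle⟩)
    have h1 : ‖y‖ - ‖z‖ ≤ dist z y := by
      rw [dist_comm, dist_eq_norm]
      exact norm_sub_norm_le y z
    linarith [hnear z hz]
  -- the competitor avoids `X ∖ s`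
  have hdisjX : Disjoint (Set.range R) (X \ Set.range s) := by
    rw [Set.disjoint_left]
    rintro z ⟨l, rfl⟩ ⟨hzX, hzs⟩
    by_cases hzxf : R l ∈ Set.range xf
    · exact (Set.disjoint_left.1 hdisj) ⟨l, rfl⟩ ⟨hzxf, hzs⟩
    · have := hfar (R l) (hRball l) (R l) ⟨hzX, hzxf⟩
      rw [dist_self] at this
      linarith
  -- Sütő's inequality in `X`
  have key := hGSC.le hs hsX hR hdisjX
  -- split both fields at the window
  have hsep' : ∀ a' ∈ X \ Set.range xf, ∀ b' ∈ X \ Set.range xf, a' ≠ b' → (7 : ℝ) / 10 ≤ dist a' b' :=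
    fun a' ha b' hb hab => hsep a' ha.1 b' hb.1 hab
  rw [fieldEnergy_sdiff_split hGSC.summable hsub hsY s, fieldEnergy_sdiff_split hGSC.summable hsub hsY R] at key
  have hfs := abs_fieldEnergy_far_le hsep' hD7 s fun i y hy => hfar (s i) (hsball i) y hy
  have hfR := abs_fieldEnergy_far_le hsep' hD7 R fun i y hy => hfar (R i) (hRball i) y hy
  have hfs' := neg_abs_le (∑ i, ∑' y : ↥(X \ Set.range xf), lennardJones (dist (s i) y))
  have hfR' := le_abs_self (∑ i, ∑' y : ↥(X \ Set.range xf), lennardJones (dist (R i) y))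
  -- the error budget `(a + m)·T(D) ≤ 2K·t ≤ ε`
  have ha : (a : ℝ) ≤ K := by exact_mod_cast haK
  have hm : (m : ℝ) ≤ K := by exact_mod_cast hmK
  have hKt : 2 * (K : ℝ) * t ≤ ε := by
    rw [htdef, mul_div_assoc', div_le_iff₀ h2K1]
    nlinarith
  have hbudget : (a : ℝ) * tailConst D + m * tailConst D ≤ ε := by nlinarith
  linarith

/-- The `e⋆`-free exchange exemption is deep-absent at the same depth. [folklore] -/
theorem deepAbsent_exchangeUnstable {ε ϱ : ℝ} {K : ℕ} (hε : 0 < ε) :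
    DeepAbsent (locOptDepth ε ϱ K) (ExchangeUnstable ε ϱ K) :=
  (deepAbsent_locOptFails hε).of_imp fun _ _ _ h => locOptFails_of_exchangeUnstable eStar h

/-! ## §4. The crux, the sibling, and the node of record BY NAME -/

/-- **`AperiodicFrustratedLawGap` BY NAME from a local-optimality-exempt price**: `MuEquilibriumDoor ∧ ExemptFDG (LocOptFails e⋆ ε ϱ K)`
(`ε > 0`) `⟹` crux — sites that are not `(ε, ϱ, K)`-optimal in their own ball are FREE. [folklore] -/
theorem aperiodicFrustratedLawGap_of_locOptExempt
    (hDoor : Summit.AtomisticToContinuum.Crystallization.Theses.GrainCoreNetworkSplit.MuEquilibriumDoor)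
    {ε ϱ : ℝ} {K : ℕ} (hε : 0 < ε) (h : ExemptFDG (LocOptFails eStar ε ϱ K)) :
    Summit.AtomisticToContinuum.Crystallization.Theses.FrustratedLawDichotomy.AperiodicFrustratedLawGap :=
  aperiodicFrustratedLawGap_of_exemptFDG hDoor (deepAbsent_locOptFails hε) h

/-- **`PeriodicFrustratedLawGap` (item 27624) BY NAME** from the same price. [folklore] -/
theorem periodicFrustratedLawGap_of_locOptExempt
    (hDoor : Summit.AtomisticToContinuum.Crystallization.Theses.GrainCoreNetworkSplit.MuEquilibriumDoor)
    {ε ϱ : ℝ} {K : ℕ} (hε : 0 < ε) (h : ExemptFDG (LocOptFails eStar ε ϱ K)) :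
    Summit.AtomisticToContinuum.Crystallization.Theses.FrustratedLawDichotomy.PeriodicFrustratedLawGap :=
  periodicFrustratedLawGap_of_exemptFDG hDoor (deepAbsent_locOptFails hε) h

/-- **The `e⋆`-free form**: `MuEquilibriumDoor ∧ ExemptFDG (ExchangeUnstable ε ϱ K) ⟹` crux. [folklore] -/
theorem aperiodicFrustratedLawGap_of_exchangeExempt
    (hDoor : Summit.AtomisticToContinuum.Crystallization.Theses.GrainCoreNetworkSplit.MuEquilibriumDoor)
    {ε ϱ : ℝ} {K : ℕ} (hε : 0 < ε) (h : ExemptFDG (ExchangeUnstable ε ϱ K)) :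
    Summit.AtomisticToContinuum.Crystallization.Theses.FrustratedLawDichotomy.AperiodicFrustratedLawGap :=
  aperiodicFrustratedLawGap_of_exemptFDG hDoor (deepAbsent_exchangeUnstable hε) h

/-- **At the node of record (range `9/2`), lens-5's `FDGopt` feed in unsplit form**: `MuEquilibriumDoor ∧ SF₄₅ ∧ UP(−0.7175) ∧
FRG♭_X(w₄₅, ω₄, 3/400; −0.7174, C, LocOptFails e⋆ ε ϱ K) ⟹` crux — every finite injective `7/10`-separated cluster satisfies
`−0.7174·N − C·#{1/20-good or not (ε, ϱ, K)-optimal} ≤ Σ_{i<j} W₄₅(r_ij) − (3/400)·N`. [folklore] -/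
theorem aperiodicFrustratedLawGap_of_schurCut_locOpt_fourHalf {ε ϱ C : ℝ} {K : ℕ}
    (hDoor : Summit.AtomisticToContinuum.Crystallization.Theses.GrainCoreNetworkSplit.MuEquilibriumDoor)
    (hF : SF₄₅) (hU : PeriodicEnergyCeiling (-(7175 / 10000))) (hε : 0 < ε)
    (hG : SchurRangeGapX w₄₅ ω₄ (3 / 400) (-(7174 / 10000)) C (LocOptFails eStar ε ϱ K)) :
    Summit.AtomisticToContinuum.Crystallization.Theses.FrustratedLawDichotomy.AperiodicFrustratedLawGap :=
  aperiodicFrustratedLawGap_of_schurCutX_fourHalf hDoor hF hU (deepAbsent_locOptFails hε) hG (by norm_num)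

/-- The same with the `e⋆`-free exchange exemption. [folklore] -/
theorem aperiodicFrustratedLawGap_of_schurCut_exchange_fourHalf {ε ϱ C : ℝ} {K : ℕ}
    (hDoor : Summit.AtomisticToContinuum.Crystallization.Theses.GrainCoreNetworkSplit.MuEquilibriumDoor)
    (hF : SF₄₅) (hU : PeriodicEnergyCeiling (-(7175 / 10000))) (hε : 0 < ε)
    (hG : SchurRangeGapX w₄₅ ω₄ (3 / 400) (-(7174 / 10000)) C (ExchangeUnstable ε ϱ K)) :
    Summit.AtomisticToContinuum.Crystallization.Theses.FrustratedLawDichotomy.AperiodicFrustratedLawGap :=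
  aperiodicFrustratedLawGap_of_schurCutX_fourHalf hDoor hF hU (deepAbsent_exchangeUnstable hε) hG (by norm_num)

end Summit.AtomisticToContinuum.Crystallization.Theorems.FrustratedLawDichotomyExemptLocOpt

end
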